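import Literature.MathematicalPhysics.QuantumFieldTheory.Balaban1983to89.B4Eq19LatticeGradientCampanato
import Literature.MathematicalPhysics.QuantumFieldTheory.Balaban1983to89.B4Eq19LatticeDirichletZero
import Literature.MathematicalPhysics.QuantumFieldTheory.Balaban1983to89.B8Eq155JBound
import Literature.MathematicalPhysics.QuantumFieldTheory.Balaban1983to89.B8Eq191FlatStencils

/-!
# `Balaban1983to89.B8FlatCurlOscillationZd` — [Balaban1985RegularSpaces] (1.55) p. 86 ∕ [Balaban1985BackgroundPropagators] (3.4) p. 391 AT THE FLAT BACKGROUND ON `ℤᵈ`: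
# **THE INTERIOR OSCILLATION ESTIMATE FOR THE FLAT PLAQUETTE FIELD `F = D^η_1φ` FROM `sup|F|` AND THE CURRENT `J = D^{η*}_1D^η_1φ`** — the components of `F` solve the
# divergence-form lattice Poisson equation `−ΔF_{μν} = ∂*g`, `g` made of `ηJ` (Bianchi identity), so the tree's discrete Campanato road
# (`B4Eq19LatticeInteriorHolder.exists_interior_holder_const`) gives `‖F_{μν}(x′) − F_{μν}(a)‖ ≤ C_d (sup_{Q_{4K+2}(a)}‖F‖ + K·η·sup_{Q_{4K+2}(a)}‖J‖)·√(ρ₀∕K)` for `x′ ∈ Q_{ρ₀}(a)`, `1 ≤ ρ₀ ≤ K`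

statement-level skeleton of published theorems with citation tags; proofs where landed; nothing here is a claim about the Yang–Mills mass gap

CITATION HEADER (lean-in-tree rule).  Cell `pub-ymgap`, seat `pub-ymgap-dag-n05-cov` g0 (director-ym R509 (a): the proof of the record's flat named facts
`B8Ineq159FlatCovPrintedRec.Ineq159Flat(Dented)CubeMemberCovPrintedZ`, `--kind proof --supports stmt-QuantumFields-20541`, K0⁷, count-neutral).  CONTENT: [folklore] lattice
calculus (the Bianchi identity `∇⁺_λF_{μν} = ∇⁺_μF_{λν} − ∇⁺_νF_{λμ}` of the flat plaquette derivative and the resulting componentwise equation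
`Σ_λ(2F_{μν} − F_{μν}(·+e_λ) − F_{μν}(·−e_λ)) = ∂*g`, `g(y,λ) = [λ=μ]S_ν(y+e_μ) − [λ=ν]S_μ(y+e_ν)`, `S_κ = Σ_λ ∇⁻_λF_{λκ} = −η·J_κ`) composed with the tree's
discrete elliptic regularity ([Giaquinta1984] Ch. III §2; files `B4Eq19Lattice*` of cell `pub-balaban` t4∕NE9).  WHY: the carried gauge letter `Θ_j` of the record's linearised
averaging ([Balaban1987RG1] (0.4); `B7Prop4FlatCarriedLetterRec`) kills constant-curl fields on centred blocks and is therefore bounded by the OSCILLATION of the fine curl;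
this file supplies that oscillation in terms of the data `|F|`, `|J|` that [Balaban1985RegularSpaces] (1.59) controls — the analytic input of the bootstrap proving (1.59)
for the record operator from its straight-average twin.  REUSED BY NAME: `B4Eq19LatticeInteriorHolder.exists_interior_holder_const`, `B4Eq19LatticeDirichletZero.exists_antideriv`,
`B4Eq19LatticeOperators.{lop, dvg, box, …}`, `B4Eq19LatticeGradientCampanato.dvg_add'`, `B8Eq146AExpansion.plaqCovDeriv_eq_covDerivFwd`, `B8Eq191FlatStencils.{covDerivFwd_flat_apply, covDeriv_flat_apply}`, `B8Eq155JBound.Jcur`.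

WHAT IS PROVED (sorry-free; proof lane — 0 `def`).
* §1 `e_eq_unitVec`, `plaqCovDeriv_one_apply'`, `plaqCovDeriv_one_swap'`, `plaqCovDeriv_one_self'`, ★ `plaqCovDeriv_one_bianchi` (the lattice Bianchi identity, forward form),
  `sum_univ_eq_Iio_add_self_add_Ioi`, ★ `eta_mul_Jcur_one_eq` (`η·J_κ(x) = −Σ_λ(F_{λκ}(x) − F_{λκ}(x − e_λ))`).
* §2 ★ `sum_secondDiff_plaqCovDeriv_eq` (`−ΔF = d(δF)` componentwise), ★★ `lop_zero_plaqCovDeriv_eq_dvg` — the divergence-form equation for `ℓ ∘ F_{μν}` on all of `ℤᵈ` (`ℓ : ℂ →ₗ[ℝ] ℝ`).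
* §3 `abs_reLm_le`, `abs_imLm_le`, `norm_le_abs_re_add_abs_im`, `norm_sum_bwdDiff_plaqCovDeriv_eq` (`= η‖J‖`), ★★★ `exists_plaqCovDeriv_osc_const` — `∃ C_d ≥ 0`: for `K ≥ 3`, `η > 0`, bounds `‖F‖ ≤ Mu`, `‖J‖ ≤ m` on `Q_{4K+2}(a)`, every `x′ ∈ Q_{ρ₀}(a)`, `1 ≤ ρ₀ ≤ K`:
  `‖F_{μν}(x′) − F_{μν}(a)‖ ≤ C_d·(Mu + K·(η·m))·√(ρ₀∕K)` (mass `K⁻²` inserted and removed by `exists_antideriv`; real and imaginary parts separately).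
HONEST SCOPE.  [folklore] lattice analysis at the flat background, ℂ-valued fields; no estimate of print by itself; `HThm4Rec` UNDISCHARGED; N05 ∕ N07 NOT discharged; counts
unmoved; one finite 𝕋⁴ programme at fixed ε — nothing continuum ∕ ℝ⁴ ∕ OS ∕ mass gap ∕ Clay.  NEW file; modifies nothing.  No `instance`, no `notation`, no `sorry`.
-/

noncomputable section

open scoped BigOperators
open Finset

namespace Literature.MathematicalPhysics.QuantumFieldTheory.Balaban1983to89.B8FlatCurlOscillationZd

open B7Prop1Explicit (e)
open B4Eq19LatticeOperators
open B4Eq19LatticeInteriorHolder (exists_interior_holder_const)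
open B4Eq19LatticeGradientCampanato (dvg_add')
open B4Eq19LatticeDirichletZero (exists_antideriv)
open B8Ineq132 (covDerivFwd covDeriv)
open B8Eq146AExpansion (plaqCovDeriv plaqCovDeriv_eq_covDerivFwd)
open B8Eq143PlaqExpansion (pdiv)
open B8Eq155JBound (Jcur Jcur_def)
open B8Eq191FlatStencils (covDerivFwd_flat_apply covDeriv_flat_apply)

variable {d : ℕ}

/-! ## §1 The flat plaquette derivative and the flat current: closed forms, antisymmetry, Bianchi -/

section Flat

variable (η : ℝ) (A : Zd d → Fin d → ℂ)

/-- `e_μ` of the engine is the unit vector of the lattice-regularity files (both `Pi.single μ 1`). [folklore] [cite: Balaban1984PropagatorsII, (1.9) p.226] -/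
theorem e_eq_unitVec (μ : Fin d) : (e μ : Zd d) = unitVec μ := rfl

/-- **(3.4) at the flat background**: `(D^η_1A)(p_{μν}(x)) = η⁻¹(A(x)_μ + A(x+e_μ)_ν − A(x+e_ν)_μ − A(x)_ν)`. [cite: Balaban1985BackgroundPropagators, (3.4) p.391] -/
theorem plaqCovDeriv_one_apply' (μ ν : Fin d) (x : Zd d) :
    plaqCovDeriv η (1 : Zd d → Fin d → ℂˣ) A μ ν x = (η⁻¹ : ℝ) • (A x μ + A (x + e μ) ν - A (x + e ν) μ - A x ν) := by
  rw [plaqCovDeriv_eq_covDerivFwd, covDerivFwd_flat_apply, covDerivFwd_flat_apply, ← smul_sub]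
  congr 1
  abel

/-- Antisymmetry of the flat plaquette derivative. [cite: Balaban1985BackgroundPropagators, (3.4) p.391] -/
theorem plaqCovDeriv_one_swap' (μ ν : Fin d) (x : Zd d) :
    plaqCovDeriv η (1 : Zd d → Fin d → ℂˣ) A ν μ x = -plaqCovDeriv η (1 : Zd d → Fin d → ℂˣ) A μ ν x := by
  rw [plaqCovDeriv_one_apply', plaqCovDeriv_one_apply', ← smul_neg]
  congr 1
  abel

/-- The flat plaquette derivative vanishes on the diagonal. [cite: Balaban1985BackgroundPropagators, (3.4) p.391] -/
theorem plaqCovDeriv_one_self' (μ : Fin d) (x : Zd d) : plaqCovDeriv η (1 : Zd d → Fin d → ℂˣ) A μ μ x = 0 := by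
  rw [plaqCovDeriv_one_apply']
  have : A x μ + A (x + e μ) μ - A (x + e μ) μ - A x μ = 0 := by abel
  rw [this, smul_zero]

/-- ★ **THE LATTICE BIANCHI IDENTITY (forward form)**: `∇⁺_λF_{μν}(x) = ∇⁺_μF_{λν}(x) − ∇⁺_νF_{λμ}(x)` for `F = D^η_1A` — forward differences commute. [folklore]
[cite: Balaban1985BackgroundPropagators, (3.4) p.391] -/
theorem plaqCovDeriv_one_bianchi (lam μ ν : Fin d) (x : Zd d) :
    plaqCovDeriv η (1 : Zd d → Fin d → ℂˣ) A μ ν (x + e lam) - plaqCovDeriv η (1 : Zd d → Fin d → ℂˣ) A μ ν x =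
      (plaqCovDeriv η (1 : Zd d → Fin d → ℂˣ) A lam ν (x + e μ) - plaqCovDeriv η (1 : Zd d → Fin d → ℂˣ) A lam ν x) -
        (plaqCovDeriv η (1 : Zd d → Fin d → ℂˣ) A lam μ (x + e ν) - plaqCovDeriv η (1 : Zd d → Fin d → ℂˣ) A lam μ x) := by
  simp only [plaqCovDeriv_one_apply', ← smul_sub]
  rw [show x + e μ + e lam = x + e lam + e μ from by abel, show x + e ν + e lam = x + e lam + e ν from by abel,
    show x + e ν + e μ = x + e μ + e ν from by abel]
  congr 1
  abel

/-- `Σ_λ f(λ) = Σ_{λ<κ} f + f(κ) + Σ_{λ>κ} f` over `Fin d`. [folklore] [cite: Balaban1985RegularSpaces, (1.2) p.76 (bookkeeping)] -/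
theorem sum_univ_eq_Iio_add_self_add_Ioi {M : Type*} [AddCommMonoid M] (κ : Fin d) (f : Fin d → M) :
    ∑ lam, f lam = ∑ lam ∈ Finset.Iio κ, f lam + f κ + ∑ lam ∈ Finset.Ioi κ, f lam := by
  rw [Fintype.sum_eq_add_sum_compl κ, ← Finset.Ioi_disjUnion_Iio, Finset.sum_disjUnion]
  abel

/-- ★ **THE FLAT CURRENT IN BACKWARD-DIFFERENCE FORM**: `η·J_κ(x) = −Σ_λ (F_{λκ}(x) − F_{λκ}(x − e_λ))` (`F = D^η_1A`; the printed `Σ_{λ<κ} D*_λF_{λκ} − Σ_{λ>κ} D*_λF_{κλ}` of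
(1.2) rewritten with the antisymmetry of `F`, the diagonal term being zero), `η ≠ 0`. [cite: Balaban1985RegularSpaces, (1.2) p.76, (1.55) p.86] -/
theorem eta_mul_Jcur_one_eq (hη : η ≠ 0) (κ : Fin d) (x : Zd d) :
    (η : ℂ) * Jcur η (1 : Zd d → Fin d → ℂˣ) A κ x =
      -∑ lam : Fin d, (plaqCovDeriv η (1 : Zd d → Fin d → ℂˣ) A lam κ x - plaqCovDeriv η (1 : Zd d → Fin d → ℂˣ) A lam κ (x - e lam)) := by
  set F := plaqCovDeriv η (1 : Zd d → Fin d → ℂˣ) A with hF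
  rw [Jcur_def]
  unfold pdiv
  simp only [covDeriv_flat_apply]
  have hswap : ∀ lam y, F κ lam y = -F lam κ y := fun lam y => by rw [hF, plaqCovDeriv_one_swap']
  have hIoi : ∑ lam ∈ Finset.Ioi κ, (η⁻¹ : ℝ) • (F κ lam (x - e lam) - F κ lam x) =
      -∑ lam ∈ Finset.Ioi κ, (η⁻¹ : ℝ) • (F lam κ (x - e lam) - F lam κ x) := by
    rw [← Finset.sum_neg_distrib]
    refine Finset.sum_congr rfl fun lam _ => ?_
    rw [hswap lam (x - e lam), hswap lam x, ← smul_neg]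
    congr 1; abel
  have hdiag : (η⁻¹ : ℝ) • (F κ κ (x - e κ) - F κ κ x) = 0 := by
    rw [hF, plaqCovDeriv_one_self', plaqCovDeriv_one_self', sub_zero, smul_zero]
  rw [hIoi, sub_neg_eq_add]
  have hsum : ∑ lam : Fin d, (η⁻¹ : ℝ) • (F lam κ (x - e lam) - F lam κ x) =
      ∑ lam ∈ Finset.Iio κ, (η⁻¹ : ℝ) • (F lam κ (x - e lam) - F lam κ x) + ∑ lam ∈ Finset.Ioi κ, (η⁻¹ : ℝ) • (F lam κ (x - e lam) - F lam κ x) := by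
    rw [sum_univ_eq_Iio_add_self_add_Ioi κ, hdiag, add_zero]
  rw [← hsum, ← Finset.smul_sum, ← Finset.sum_neg_distrib]
  -- `η · (η⁻¹ • S) = S`
  rw [Complex.real_smul, ← mul_assoc, Complex.ofReal_inv, mul_inv_cancel₀ (Complex.ofReal_ne_zero.mpr hη), one_mul]
  refine Finset.sum_congr rfl fun lam _ => ?_
  abel

end Flat

/-! ## §2 The componentwise divergence-form equation for `F_{μν}` on `ℤᵈ` -/

section Equation

variable (η : ℝ) (A : Zd d → Fin d → ℂ)

/-- ★★ **THE COMPONENTWISE IDENTITY `Σ_λ(2F_{μν}(y) − F_{μν}(y+e_λ) − F_{μν}(y−e_λ)) = (S_ν(y) − S_ν(y+e_μ)) − (S_μ(y) − S_μ(y+e_ν))`** with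
`S_κ(x) = Σ_λ(F_{λκ}(x) − F_{λκ}(x−e_λ))` (`= −η·J_κ(x)`), `F = D^η_1A`: the Bianchi identity at `y` and at `y − e_λ`, summed over `λ` — i.e. `−ΔF = d(δF)` componentwise on the cubic
complex. [folklore] [cite: Balaban1985BackgroundPropagators, (3.4) p.391, (3.8) p.392] -/
theorem sum_secondDiff_plaqCovDeriv_eq (μ ν : Fin d) (y : Zd d) :
    ∑ lam : Fin d, (2 * plaqCovDeriv η (1 : Zd d → Fin d → ℂˣ) A μ ν y - plaqCovDeriv η (1 : Zd d → Fin d → ℂˣ) A μ ν (y + e lam) -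
        plaqCovDeriv η (1 : Zd d → Fin d → ℂˣ) A μ ν (y - e lam)) =
      (∑ l : Fin d, (plaqCovDeriv η (1 : Zd d → Fin d → ℂˣ) A l ν y - plaqCovDeriv η (1 : Zd d → Fin d → ℂˣ) A l ν (y - e l)) -
          ∑ l : Fin d, (plaqCovDeriv η (1 : Zd d → Fin d → ℂˣ) A l ν (y + e μ) - plaqCovDeriv η (1 : Zd d → Fin d → ℂˣ) A l ν (y + e μ - e l))) -
        (∑ l : Fin d, (plaqCovDeriv η (1 : Zd d → Fin d → ℂˣ) A l μ y - plaqCovDeriv η (1 : Zd d → Fin d → ℂˣ) A l μ (y - e l)) -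
          ∑ l : Fin d, (plaqCovDeriv η (1 : Zd d → Fin d → ℂˣ) A l μ (y + e ν) - plaqCovDeriv η (1 : Zd d → Fin d → ℂˣ) A l μ (y + e ν - e l))) := by
  set F := plaqCovDeriv η (1 : Zd d → Fin d → ℂˣ) A with hF
  simp only [← Finset.sum_sub_distrib]
  refine Finset.sum_congr rfl fun l _ => ?_
  have b1 := plaqCovDeriv_one_bianchi η A l μ ν y
  have b2 := plaqCovDeriv_one_bianchi η A l μ ν (y - e l)
  rw [sub_add_cancel, show y - e l + e μ = y + e μ - e l from by abel, show y - e l + e ν = y + e ν - e l from by abel] at b2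
  rw [← hF] at b1 b2
  linear_combination -b1 + b2

/-- ★★ **`−ΔF_{μν} = ∂*g` ON ALL OF `ℤᵈ`, read through an `ℝ`-linear functional `ℓ : ℂ → ℝ`** (in the letters of `B4Eq19LatticeOperators`): `lop 0 (ℓ ∘ F_{μν}) = dvg (ℓ ∘ g)` with
`g(x, λ) = [λ = μ]·S_ν(x + e_μ) − [λ = ν]·S_μ(x + e_ν)`. [folklore] [cite: Balaban1985BackgroundPropagators, (3.4) p.391, (3.8) p.392; Giaquinta1984, Ch. III §2 p.77] -/
theorem lop_zero_plaqCovDeriv_eq_dvg (ℓ : ℂ →ₗ[ℝ] ℝ) (μ ν : Fin d) (y : Zd d) :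
    lop 0 (fun x => ℓ (plaqCovDeriv η (1 : Zd d → Fin d → ℂˣ) A μ ν x)) y =
      dvg (fun x lam => ℓ ((if lam = μ then ∑ l : Fin d, (plaqCovDeriv η (1 : Zd d → Fin d → ℂˣ) A l ν (x + e μ) -
              plaqCovDeriv η (1 : Zd d → Fin d → ℂˣ) A l ν (x + e μ - e l)) else 0) -
          (if lam = ν then ∑ l : Fin d, (plaqCovDeriv η (1 : Zd d → Fin d → ℂˣ) A l μ (x + e ν) -
              plaqCovDeriv η (1 : Zd d → Fin d → ℂˣ) A l μ (x + e ν - e l)) else 0))) y := by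
  classical
  set F := plaqCovDeriv η (1 : Zd d → Fin d → ℂˣ) A with hF
  have key := sum_secondDiff_plaqCovDeriv_eq η A μ ν y
  rw [← hF] at key
  rw [lop_apply, dvg_apply, zero_mul, add_zero]
  -- left: pull `ℓ` out
  have hL : ∑ lam : Fin d, (2 * ℓ (F μ ν y) - ℓ (F μ ν (y + unitVec lam)) - ℓ (F μ ν (y - unitVec lam))) =
      ℓ (∑ lam : Fin d, (2 * F μ ν y - F μ ν (y + e lam) - F μ ν (y - e lam))) := by
    rw [map_sum]
    refine Finset.sum_congr rfl fun lam _ => ?_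
    rw [map_sub, map_sub, show (2 : ℂ) * F μ ν y = (2 : ℝ) • F μ ν y from by rw [Complex.real_smul]; norm_num, map_smul, smul_eq_mul]
    rfl
  -- right: evaluate the two indicator sums, then pull `ℓ` out
  have hR' : ∑ lam : Fin d, (((if lam = μ then ∑ l : Fin d, (F l ν (y - unitVec lam + e μ) - F l ν (y - unitVec lam + e μ - e l)) else 0) -
        (if lam = ν then ∑ l : Fin d, (F l μ (y - unitVec lam + e ν) - F l μ (y - unitVec lam + e ν - e l)) else 0)) -
        ((if lam = μ then ∑ l : Fin d, (F l ν (y + e μ) - F l ν (y + e μ - e l)) else 0) -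
        (if lam = ν then ∑ l : Fin d, (F l μ (y + e ν) - F l μ (y + e ν - e l)) else 0))) =
      (∑ l : Fin d, (F l ν y - F l ν (y - e l)) - ∑ l : Fin d, (F l ν (y + e μ) - F l ν (y + e μ - e l))) -
        (∑ l : Fin d, (F l μ y - F l μ (y - e l)) - ∑ l : Fin d, (F l μ (y + e ν) - F l μ (y + e ν - e l))) := by
    simp only [Finset.sum_sub_distrib, Finset.sum_ite_eq', Finset.mem_univ, if_true, ← e_eq_unitVec, sub_add_cancel]
    abel
  have hR : ∑ lam : Fin d, (ℓ ((if lam = μ then ∑ l : Fin d, (F l ν (y - unitVec lam + e μ) - F l ν (y - unitVec lam + e μ - e l)) else 0) -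
        (if lam = ν then ∑ l : Fin d, (F l μ (y - unitVec lam + e ν) - F l μ (y - unitVec lam + e ν - e l)) else 0)) -
        ℓ ((if lam = μ then ∑ l : Fin d, (F l ν (y + e μ) - F l ν (y + e μ - e l)) else 0) -
        (if lam = ν then ∑ l : Fin d, (F l μ (y + e ν) - F l μ (y + e ν - e l)) else 0))) =
      ℓ ((∑ l : Fin d, (F l ν y - F l ν (y - e l)) - ∑ l : Fin d, (F l ν (y + e μ) - F l ν (y + e μ - e l))) -
        (∑ l : Fin d, (F l μ y - F l μ (y - e l)) - ∑ l : Fin d, (F l μ (y + e ν) - F l μ (y + e ν - e l)))) := by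
    rw [← hR', map_sum]
    refine Finset.sum_congr rfl fun lam _ => ?_
    exact (map_sub ℓ _ _).symm
  rw [hL, hR, key]

end Equation


/-! ## §3 The interior oscillation estimate for `F = D^η_1φ` -/

section Oscillation

/-- `|re z| ≤ ‖z‖`. [folklore] [cite: Giaquinta1984, Ch. III §2 p.77 (bookkeeping)] -/
theorem abs_reLm_le (z : ℂ) : |Complex.reLm z| ≤ ‖z‖ := by simpa using Complex.abs_re_le_norm z

/-- `|im z| ≤ ‖z‖`. [folklore] [cite: Giaquinta1984, Ch. III §2 p.77 (bookkeeping)] -/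
theorem abs_imLm_le (z : ℂ) : |Complex.imLm z| ≤ ‖z‖ := by simpa using Complex.abs_im_le_norm z

/-- `‖z‖ ≤ |re z| + |im z|`. [folklore] [cite: Giaquinta1984, Ch. III §2 p.77 (bookkeeping)] -/
theorem norm_le_abs_re_add_abs_im (z : ℂ) : ‖z‖ ≤ |Complex.reLm z| + |Complex.imLm z| := by
  simpa using Complex.norm_le_abs_re_add_abs_im z

/-- **The size of the flat current in backward-difference form**: `‖Σ_λ(F_{λκ}(z) − F_{λκ}(z − e_λ))‖ = η·‖J_κ(z)‖` (`η > 0`). [cite: Balaban1985RegularSpaces, (1.2) p.76, (1.55) p.86] -/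
theorem norm_sum_bwdDiff_plaqCovDeriv_eq {η : ℝ} (hη : 0 < η) (A : Zd d → Fin d → ℂ) (κ : Fin d) (z : Zd d) :
    ‖∑ lam : Fin d, (plaqCovDeriv η (1 : Zd d → Fin d → ℂˣ) A lam κ z - plaqCovDeriv η (1 : Zd d → Fin d → ℂˣ) A lam κ (z - e lam))‖ =
      η * ‖Jcur η (1 : Zd d → Fin d → ℂˣ) A κ z‖ := by
  have h := eta_mul_Jcur_one_eq η A hη.ne' κ z
  rw [← norm_neg, ← h, norm_mul, Complex.norm_real, Real.norm_of_nonneg hη.le]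

/-- ★★★ **THE INTERIOR OSCILLATION ESTIMATE FOR THE FLAT PLAQUETTE FIELD.**  There is `C_d ≥ 0` such that for every `K ≥ 3`, `η > 0`, every ℂ-valued bond field `A` on `ℤᵈ`, every centre
`a`, and bounds `‖(D^η_1A)(p_{κν}(y))‖ ≤ Mu`, `‖J(A)_κ(y)‖ ≤ m` for `y ∈ Q_{4K+2}(a)` (`J = D^{η*}_1D^η_1A` of (1.55)): for all `μ, ν`, `x′ ∈ Q_{ρ₀}(a)`, `1 ≤ ρ₀ ≤ K`,
`‖(D^η_1A)(p_{μν}(x′)) − (D^η_1A)(p_{μν}(a))‖ ≤ C_d·(Mu + K·(η·m))·√(ρ₀∕K)` — the components of `F` solve `(−Δ + K⁻²)F_{μν} = ∂*(g + g₀)` on `Q_{4K}(a)` with `|g| ≤ 2ηm`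
(`lop_zero_plaqCovDeriv_eq_dvg`) and `|g₀| ≤ (8K+1)Mu∕K²` (`exists_antideriv` of the mass term), so `exists_interior_holder_const` applies to the real and imaginary parts.
[folklore] [cite: Giaquinta1984, Ch. III §2 Thm 2.2 p.78, §1 Thm 1.2 p.70; Balaban1985BackgroundPropagators, (3.4) p.391; Balaban1985RegularSpaces, (1.55) p.86] -/
theorem exists_plaqCovDeriv_osc_const (d : ℕ) (hd : 1 ≤ d) : ∃ C : ℝ, 0 ≤ C ∧
    ∀ (K : ℕ), 3 ≤ K → ∀ (η : ℝ), 0 < η → ∀ (A : Zd d → Fin d → ℂ) (a : Zd d) (Mu m : ℝ), 0 ≤ Mu → 0 ≤ m →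
      (∀ y ∈ box a (4 * (K : ℤ) + 2), ∀ κ ν, ‖plaqCovDeriv η (1 : Zd d → Fin d → ℂˣ) A κ ν y‖ ≤ Mu) →
      (∀ y ∈ box a (4 * (K : ℤ) + 2), ∀ κ, ‖Jcur η (1 : Zd d → Fin d → ℂˣ) A κ y‖ ≤ m) →
      ∀ (μ ν : Fin d) (x' : Zd d) (ρ₀ : ℕ), 1 ≤ ρ₀ → ρ₀ ≤ K → x' ∈ box a (ρ₀ : ℤ) →
        ‖plaqCovDeriv η (1 : Zd d → Fin d → ℂˣ) A μ ν x' - plaqCovDeriv η (1 : Zd d → Fin d → ℂˣ) A μ ν a‖ ≤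
          C * (Mu + K * (η * m)) * Real.sqrt ((ρ₀ : ℝ) / K) := by
  classical
  obtain ⟨C, hC0, hH⟩ := exists_interior_holder_const d hd
  refine ⟨20 * C, by positivity, ?_⟩
  intro K hK η hη A a Mu m hMu hm hF hJ μ ν x' ρ₀ hρ₀ hρ₀K hx'
  set F := plaqCovDeriv η (1 : Zd d → Fin d → ℂˣ) A with hFdef
  have hK1 : (1 : ℝ) ≤ K := by exact_mod_cast (show 1 ≤ K by omega)
  have hK0 : (0 : ℝ) < K := by linarith
  -- box bookkeeping
  have hsub0 : box a (4 * (K : ℤ)) ⊆ box a (4 * (K : ℤ) + 2) := box_mono a (by omega)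
  have hsub1 : ∀ y ∈ box a (4 * (K : ℤ)), ∀ κ, y + e κ ∈ box a (4 * (K : ℤ) + 2) := fun y hy κ =>
    box_mono a (show (4 * (K : ℤ) + 1) ≤ 4 * (K : ℤ) + 2 by omega) (by rw [e_eq_unitVec]; exact add_unitVec_mem_box hy κ)
  -- the source `S_κ` is `η`-small: `‖Σ_λ(F_{λκ}(z) − F_{λκ}(z − e_λ))‖ ≤ η·m` on `Q_{4K+2}(a)`
  have hS : ∀ z ∈ box a (4 * (K : ℤ) + 2), ∀ κ, ‖∑ lam : Fin d, (F lam κ z - F lam κ (z - e lam))‖ ≤ η * m := by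
    intro z hz κ
    rw [hFdef, norm_sum_bwdDiff_plaqCovDeriv_eq hη A κ z]
    exact mul_le_mul_of_nonneg_left (hJ z hz κ) hη.le
  -- the estimate for `ℓ ∘ F_{μν}`, `ℓ = re, im`
  have key : ∀ ℓ : ℂ →ₗ[ℝ] ℝ, (∀ z, |ℓ z| ≤ ‖z‖) →
      |ℓ (F μ ν x') - ℓ (F μ ν a)| ≤ 10 * C * (Mu + K * (η * m)) * Real.sqrt ((ρ₀ : ℝ) / K) := by
    intro ℓ hℓ
    set u : Zd d → ℝ := fun x => ℓ (F μ ν x) with hu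
    set g : Zd d → Fin d → ℝ := fun x lam => ℓ ((if lam = μ then ∑ l : Fin d, (F l ν (x + e μ) - F l ν (x + e μ - e l)) else 0) -
        (if lam = ν then ∑ l : Fin d, (F l μ (x + e ν) - F l μ (x + e ν - e l)) else 0)) with hg
    have hEq0 : ∀ y, lop 0 u y = dvg g y := fun y => lop_zero_plaqCovDeriv_eq_dvg η A ℓ μ ν y
    -- the mass term as a divergence
    have hf₀ : ∀ y ∈ box a (4 * (K : ℤ)), |1 / (K : ℝ) ^ 2 * u y| ≤ Mu / (K : ℝ) ^ 2 := by
      intro y hy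
      rw [abs_mul, abs_of_nonneg (by positivity : (0 : ℝ) ≤ 1 / (K : ℝ) ^ 2), one_div_mul_eq_div]
      exact div_le_div_of_nonneg_right ((hℓ _).trans (hF y (hsub0 hy) μ ν)) (by positivity)
    obtain ⟨g₀, hg₀eq, hg₀b⟩ := exists_antideriv (by omega : 0 < d) (fun y => 1 / (K : ℝ) ^ 2 * u y) a (4 * (K : ℤ)) hf₀
    have hEq : ∀ y ∈ box a (4 * (K : ℤ)), lop (1 / (K : ℝ) ^ 2) u y = dvg (fun x lam => g x lam + g₀ x lam) y := by
      intro y hy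
      rw [dvg_add', ← hEq0 y, hg₀eq y hy, lop_apply, lop_apply]
      ring
    have hub : ∀ y ∈ box a (4 * (K : ℤ)), |u y| ≤ Mu := fun y hy => (hℓ _).trans (hF y (hsub0 hy) μ ν)
    have hgb : ∀ y ∈ box a (4 * (K : ℤ)), ∀ lam, |g y lam + g₀ y lam| ≤ 2 * (η * m) + (2 * (4 * (K : ℤ)) + 1 : ℤ) * (Mu / (K : ℝ) ^ 2) := by
      intro y hy lam
      refine (abs_add_le _ _).trans (add_le_add ?_ ?_)
      · refine (hℓ _).trans ((norm_sub_le _ _).trans ?_)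
        have h1 : ‖(if lam = μ then ∑ l : Fin d, (F l ν (y + e μ) - F l ν (y + e μ - e l)) else 0)‖ ≤ η * m := by
          split_ifs
          · exact hS _ (hsub1 y hy μ) ν
          · rw [norm_zero]; positivity
        have h2 : ‖(if lam = ν then ∑ l : Fin d, (F l μ (y + e ν) - F l μ (y + e ν - e l)) else 0)‖ ≤ η * m := by
          split_ifs
          · exact hS _ (hsub1 y hy ν) μ
          · rw [norm_zero]; positivity
        linarith
      · have := hg₀b y hy lam
        push_cast at this ⊢
        exact this
    have hmtot : (0 : ℝ) ≤ 2 * (η * m) + (2 * (4 * (K : ℤ)) + 1 : ℤ) * (Mu / (K : ℝ) ^ 2) := by push_cast; positivity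
    have hfin := hH K hK u (fun x lam => g x lam + g₀ x lam) a Mu _ hMu hmtot hEq hub hgb x' ρ₀ hρ₀ hρ₀K hx'
    -- arithmetic: `Mu + K·(2ηm + (8K+1)Mu∕K²) ≤ 10·(Mu + K·η·m)`
    have harith : Mu + (K : ℝ) * (2 * (η * m) + (2 * (4 * (K : ℤ)) + 1 : ℤ) * (Mu / (K : ℝ) ^ 2)) ≤ 10 * (Mu + K * (η * m)) := by
      push_cast
      have h1 : (K : ℝ) * ((2 * (4 * (K : ℝ)) + 1) * (Mu / (K : ℝ) ^ 2)) = (8 * K + 1) / K * Mu := by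
        field_simp
        ring
      have h2 : (8 * (K : ℝ) + 1) / K ≤ 9 := by rw [div_le_iff₀ hK0]; linarith
      have h3 : (8 * (K : ℝ) + 1) / K * Mu ≤ 9 * Mu := mul_le_mul_of_nonneg_right h2 hMu
      have h4 : 0 ≤ (K : ℝ) * (η * m) := by positivity
      nlinarith [h1, h3, h4]
    have hsq : 0 ≤ Real.sqrt ((ρ₀ : ℝ) / K) := Real.sqrt_nonneg _
    calc |ℓ (F μ ν x') - ℓ (F μ ν a)| = |u x' - u a| := rfl
      _ ≤ C * (Mu + K * (2 * (η * m) + (2 * (4 * (K : ℤ)) + 1 : ℤ) * (Mu / (K : ℝ) ^ 2))) * Real.sqrt ((ρ₀ : ℝ) / K) := hfin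
      _ ≤ C * (10 * (Mu + K * (η * m))) * Real.sqrt ((ρ₀ : ℝ) / K) := by gcongr
      _ = 10 * C * (Mu + K * (η * m)) * Real.sqrt ((ρ₀ : ℝ) / K) := by ring
  have hre := key Complex.reLm abs_reLm_le
  have him := key Complex.imLm abs_imLm_le
  calc ‖F μ ν x' - F μ ν a‖ ≤ |Complex.reLm (F μ ν x' - F μ ν a)| + |Complex.imLm (F μ ν x' - F μ ν a)| := norm_le_abs_re_add_abs_im _
    _ = |Complex.reLm (F μ ν x') - Complex.reLm (F μ ν a)| + |Complex.imLm (F μ ν x') - Complex.imLm (F μ ν a)| := by rw [map_sub, map_sub]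
    _ ≤ 10 * C * (Mu + K * (η * m)) * Real.sqrt ((ρ₀ : ℝ) / K) + 10 * C * (Mu + K * (η * m)) * Real.sqrt ((ρ₀ : ℝ) / K) := add_le_add hre him
    _ = 20 * C * (Mu + K * (η * m)) * Real.sqrt ((ρ₀ : ℝ) / K) := by ring

end Oscillation

end Literature.MathematicalPhysics.QuantumFieldTheory.Balaban1983to89.B8FlatCurlOscillationZd

end
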